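import Literature.Computability.Cryptography.InaccessibleEntropyUOWHFFamily
import HarnessLib

/-!
# Merkle–Damgård composition of a leveled `(d, d−1)`-restricted hash family at a fixed level

Topic `Literature/Computability/Cryptography`. Goldreich's Step II (Construction 6.4.22) composes functions taken
from a `(d, d−1)`-UOWHF at *consecutive* domain lengths `d(n), d(n)−1, …`; this presupposes that the basic
collection is available at every domain length (`d` onto). The families produced by the inaccessible-entropy
construction (`HHRVW.family p f`, file `InaccessibleEntropyUOWHFMain.lean`) are *leveled*: at parameter `n` the
index is `1ⁿ 0 r` with `|r| = p(n)` and the function maps `{0,1}^{d(n)} → {0,1}^{d(n)−1}`, the admissible domain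
lengths `d(n)` being sparse. This file gives the composition that such leveled families support directly:
**Merkle–Damgård chaining at the same level** (Goldreich 2004, Construction 6.4.22 specialised to one level;
Damgård 1989 / Naor–Yung 1989 composition lemma; HHRVW 2020, Lemma 5.7). View `h_s : {0,1}^d → {0,1}^{d−1}` as a
compression function from a `(d−1)`-bit state and one fresh bit to a `(d−1)`-bit state; with `R + 1` independent
level-`n` indices `s_0, …, s_R` the chained function maps `{0,1}^{d + R} → {0,1}^{d−1}` (so `R = d − 2` gives a
factor-`2` shrinkage):

`z₀ = x ↾ d`, `z_{r+1} = h_{s_r}(z_r) ++ x_{d+r}` (`r < R`), output `h_{s_R}(z_R)`.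

The new index at level `n` is `1ⁿ 0 (r_0 ++ ⋯ ++ r_R ++ padding)` on `p₂(n) ≥ (R(n)+1)·p(n)` coins, so the composed
collection has the same "leveled" shape (`pShaped p₂ …`) as the basic one (`pShaped p …`), and the step can be
iterated or followed by tree hashing. Main content:

* `Spec` (the basic brick `hb` on `⟨s, x⟩`, coin polynomial `p`, domain length `dL`, extra levels `R`, unary
  bricks for `dL`, `R`, a clock bound and the composed coin polynomial `p₂`) with its well-formedness `Spec.WF`;
  `pShaped p hb : HashCollection` (index `1ⁿ0r` on `p(n)` coins, hash `hb ⟨s, x⟩`), so that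
  `HHRVW.family p f = pShaped p (HHRVW.hashP p f)` definitionally;
* string semantics `keyAt`, `chainSt`, `chainOutStr` and the composed brick `hashC S` with `hashC_apply`
  (value on well-formed indices), `length_hashC` (range `dL(level |s|) − 1` on ALL inputs), `hashC_mem_FP`;
* `compose S : HashCollection := pShaped S.p₂ (hashC S)`, `dLenC/rLenC`, `isEfficient_compose`, index lengths.

The security reduction (a designated collision of the chain is a designated collision at a uniformly guessed
level, planted) is the next file. All statements proved; no named facts.

## References

* O. Goldreich, *Foundations of Cryptography II*, CUP 2004, §6.4.3.2, Construction 6.4.22 and Prop. 6.4.23.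
* I. Damgård, *A design principle for hash functions*, CRYPTO 1989; M. Naor, M. Yung, STOC 1989, Lemma 2.1.
* I. Haitner et al., *Inaccessible Entropy II*, Theory of Computing 16(8) (2020), Lemma 5.7.
-/

namespace Literature.Computability.Cryptography

namespace MDCompose

open _root_.Computability Complexity Complexity.Brick Complexity.Plumb Polynomial
open HHRVW (catF catF_apply catF_mem_FP fitLen length_fitLen fitLen_of_length_eq)

/-! ### Leveled ("p-shaped") collections -/

/-- **The `p`-shaped collection of a hash brick**: `I(1ⁿ; r) = 1ⁿ 0 r` on `p(n)` coins and `h_s(x) = hb ⟨s, x⟩`.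
(`HHRVW.family p f` is `pShaped p (HHRVW.hashP p f)` by `rfl`.) [cite: Goldreich2004, Def. 6.4.19; HaitnerEtAl2020, Thm. 5.1 (the family `G`)] -/
def pShaped (p : Polynomial ℕ) (hb : List Bool → List Bool) : HashCollection where
  index := { run := fun n r => unaryEncodeNat n ++ false :: r, coinLen := fun L => p.eval L }
  hash := fun s x => hb (boolPair s x)

/-- `HHRVW.family p f = pShaped p (hashP p f)`. [folklore] -/
theorem family_eq_pShaped (p : Polynomial ℕ) (f : List Bool → List Bool) : HHRVW.family p f = pShaped p (HHRVW.hashP p f) := rfl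

/-- The index at parameter `n` with coins `r` is `1ⁿ 0 r`. [folklore] -/
theorem pShaped_index_run (p : Polynomial ℕ) (hb : List Bool → List Bool) (n : ℕ) (r : List Bool) :
    (pShaped p hb).index.run n r = ones n ++ false :: r := by
  show unaryEncodeNat n ++ false :: r = _
  rw [unaryEncodeNat_eq_replicate]

/-- The coin budget of a `p`-shaped collection. [folklore] -/
@[simp] theorem pShaped_index_coinLen (p : Polynomial ℕ) (hb : List Bool → List Bool) (L : ℕ) : (pShaped p hb).index.coinLen L = p.eval L := rfl

/-- The hash of a `p`-shaped collection. [folklore] -/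
@[simp] theorem pShaped_hash (p : Polynomial ℕ) (hb : List Bool → List Bool) (s x : List Bool) : (pShaped p hb).hash s x = hb (boolPair s x) := rfl

/-- Indices in the range of `I(1ⁿ)` are `1ⁿ 0 r` with `|r| = p(n)`. [folklore] -/
theorem mem_support_pShaped_index {p : Polynomial ℕ} {hb : List Bool → List Bool} {n : ℕ} {s : List Bool}
    (hs : s ∈ ((pShaped p hb).indexPMF n).support) : ∃ r : List Bool, r.length = p.eval n ∧ s = ones n ++ false :: r := by
  rw [HashCollection.indexPMF, RandAlg.outputPMF, PMF.support_map] at hs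
  obtain ⟨ρ, _, rfl⟩ := hs
  refine ⟨ρ.toList, ?_, pShaped_index_run p hb n _⟩
  rw [List.Vector.toList_length]
  show p.eval (unaryEncodeNat n).length = _
  rw [unaryEncodeNat_eq_replicate, List.length_replicate]

/-- Every index in the range of `I(1ⁿ)` has length `p(n) + n + 1 = LenPres.M p n`. [cite: Goldreich2004, Def. 6.4.19 (1)] -/
theorem length_index_pShaped {p : Polynomial ℕ} {hb : List Bool → List Bool} {n : ℕ} {s : List Bool}
    (hs : s ∈ ((pShaped p hb).indexPMF n).support) : s.length = LenPres.M p n := by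
  obtain ⟨r, hr, rfl⟩ := mem_support_pShaped_index hs
  simp [ones, hr, LenPres.M]; ring

/-- The level of a well-formed index: `nOf p |1ⁿ0r| = n` for `|r| = p n`. [folklore] -/
theorem nOf_length_idx (p : Polynomial ℕ) (n : ℕ) {r : List Bool} (hr : r.length = p.eval n) :
    LenPres.nOf p (ones n ++ false :: r).length = n := by
  have hL : (ones n ++ false :: r).length = LenPres.M p n := by simp [ones, hr, LenPres.M]; ring
  rw [hL]; exact LenPres.nOf_eq le_rfl (LenPres.M_strictMono (Nat.lt_succ_self n))

/-! ### The specification of a composition -/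

/-- The data of a same-level Merkle–Damgård composition: the basic hash brick `hb` (on `⟨s, x⟩`), its coin polynomial
`p` (indices `1ⁿ0r`, `|r| = p n`), its domain length `dL n` at level `n` (range `dL n − 1`), the number `R n` of extra
chain levels (keys `R n + 1`, domain `dL n + R n`), unary bricks computing `dL` and `R` from `1ⁿ`, a polynomial clock
bound `PR ≥ R`, and the coin polynomial `p₂` of the composed collection. [cite: Goldreich2004, Construction 6.4.22] -/
structure Spec where
  /-- The basic hash brick on `⟨s, x⟩`. -/
  hb : List Bool → List Bool
  /-- Coins of the basic index: `s = 1ⁿ 0 r`, `|r| = p(n)`. -/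
  p : Polynomial ℕ
  /-- Domain length of the basic function at level `n` (its range is `dL n − 1`). -/
  dL : ℕ → ℕ
  /-- Extra chain levels (`R n + 1` keys; domain `dL n + R n`). -/
  R : ℕ → ℕ
  /-- Unary brick for `dL`. -/
  dLF : List Bool → List Bool
  /-- Unary brick for `R`. -/
  RF : List Bool → List Bool
  /-- Polynomial clock bound on `R`. -/
  PR : Polynomial ℕ
  /-- Coins of the composed index. -/
  p₂ : Polynomial ℕ

/-- Well-formedness of a specification. [cite: Goldreich2004, Construction 6.4.22 ("tedious details")] -/
structure Spec.WF (S : Spec) : Prop where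
  hb_mem : S.hb ∈ FP
  dLF_apply : ∀ n, S.dLF (ones n) = ones (S.dL n)
  RF_apply : ∀ n, S.RF (ones n) = ones (S.R n)
  dLF_mem : S.dLF ∈ FP
  RF_mem : S.RF ∈ FP
  R_le : ∀ n, S.R n ≤ S.PR.eval n
  p₂_ge : ∀ n, (S.R n + 1) * S.p.eval n ≤ S.p₂.eval n
  one_le_p : ∀ n, 1 ≤ S.p.eval n
  two_le_dL : ∀ n, 2 ≤ S.dL n
  length_hb : ∀ (n : ℕ) (r x : List Bool), r.length = S.p.eval n → x.length = S.dL n →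
    (S.hb (boolPair (ones n ++ false :: r) x)).length = S.dL n - 1

variable (S : Spec)

/-- The basic collection of a specification. [cite: Goldreich2004, Def. 6.4.19] -/
def base : HashCollection := pShaped S.p S.hb

/-! ### String semantics of the chain -/

section Strings

variable (n : ℕ) (kb x : List Bool)

/-- Key `r` of the composed index coins: the `r`-th block of `p(n)` coins. [cite: Goldreich2004, Construction 6.4.22] -/
def keyAt (r : ℕ) : List Bool := (kb.drop (r * S.p.eval n)).take (S.p.eval n)

/-- The basic index of key `r`: `1ⁿ 0 (key r)`. [folklore] -/
def idxAt (r : ℕ) : List Bool := ones n ++ false :: keyAt S n kb r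

/-- The chain states: `z₀ = x ↾ d`, `z_{r+1} = h_{s_r}(z_r) ++ x_{d+r}`. [cite: Goldreich2004, Construction 6.4.22; HaitnerEtAl2020, Lemma 5.7] -/
def chainSt : ℕ → List Bool
  | 0 => x.take (S.dL n)
  | r + 1 => S.hb (boolPair (idxAt S n kb r) (chainSt r)) ++ (x.drop (S.dL n + r)).take 1

/-- The chained value `h_{s_R}(z_R)`. [cite: Goldreich2004, Construction 6.4.22] -/
def chainOutStr : List Bool := S.hb (boolPair (idxAt S n kb (S.R n)) (chainSt S n kb x (S.R n)))

variable {S n kb x}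

/-- `|key r| = p n` when the coins are long enough. [folklore] -/
theorem length_keyAt (hkb : (S.R n + 1) * S.p.eval n ≤ kb.length) {r : ℕ} (hr : r ≤ S.R n) : (keyAt S n kb r).length = S.p.eval n := by
  rw [keyAt, List.length_take, List.length_drop, min_eq_left]
  have : (r + 1) * S.p.eval n ≤ kb.length := le_trans (Nat.mul_le_mul_right _ (by omega)) hkb
  rw [Nat.succ_mul] at this; omega

/-- `|key r| ≤ p n` always. [folklore] -/
theorem length_keyAt_le (r : ℕ) : (keyAt S n kb r).length ≤ S.p.eval n := by rw [keyAt]; exact List.length_take_le _ _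

/-- `|z_r| = d` for `r ≤ R`, on well-formed data. [folklore] -/
theorem length_chainSt (hS : S.WF) (hkb : (S.R n + 1) * S.p.eval n ≤ kb.length) (hx : x.length = S.dL n + S.R n) :
    ∀ {r : ℕ}, r ≤ S.R n → (chainSt S n kb x r).length = S.dL n
  | 0, _ => by rw [chainSt, List.length_take, hx, min_eq_left (Nat.le_add_right _ _)]
  | r + 1, hr => by
    rw [chainSt, List.length_append, idxAt, hS.length_hb n _ _ (length_keyAt hkb (by omega)) (length_chainSt hS hkb hx (by omega)),
      List.length_take, List.length_drop, hx, min_eq_left (by omega)]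
    have := hS.two_le_dL n; omega

/-- `|chainOutStr| = d − 1` on well-formed data. [folklore] -/
theorem length_chainOutStr (hS : S.WF) (hkb : (S.R n + 1) * S.p.eval n ≤ kb.length) (hx : x.length = S.dL n + S.R n) :
    (chainOutStr S n kb x).length = S.dL n - 1 :=
  hS.length_hb n _ _ (length_keyAt hkb le_rfl) (length_chainSt hS hkb hx le_rfl)

end Strings

/-! ### The bricks -/

section Bricks

/-- `1ⁿ` from the record `X = ⟨1ⁿ, ⟨kb, x⟩⟩`. [folklore] -/
noncomputable def CnF : List Bool → List Bool := fstF
/-- `kb` from `X`. [folklore] -/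
noncomputable def CkbF : List Bool → List Bool := nthF 1
/-- `x` from `X`. [folklore] -/
noncomputable def CxF : List Bool → List Bool := sndPow 1
/-- `1^{p n}` from `X`. [folklore] -/
noncomputable def CpF : List Bool → List Bool := polyFn S.p ∘ CnF
/-- `1^{dL n}` from `X`. [folklore] -/
noncomputable def CdF : List Bool → List Bool := S.dLF ∘ CnF
/-- `1^{R n}` from `X`. [folklore] -/
noncomputable def CRF : List Bool → List Bool := S.RF ∘ CnF

variable (n : ℕ) (kb x : List Bool)

/-- The record `X`. [folklore] -/
def Xrec : List Bool := boolPair (ones n) (boolPair kb x)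

/-- The loop record `⟨X, ⟨cnt, ⟨1ʳ, st⟩⟩⟩`. [folklore] -/
def Zrec (cnt : List Bool) (r : ℕ) (st : List Bool) : List Bool := boolPair (Xrec n kb x) (boolPair cnt (boolPair (ones r) st))

variable {n kb x}

/-- Accessor value. [folklore] -/
@[simp] theorem XnF_X : CnF (Xrec n kb x) = ones n := by simp [CnF, Xrec]
/-- Accessor value. [folklore] -/
@[simp] theorem XkF_X : CkbF (Xrec n kb x) = kb := by simp [CkbF, Xrec, nthF]
/-- Accessor value. [folklore] -/
@[simp] theorem XxF_X : CxF (Xrec n kb x) = x := by simp [CxF, Xrec]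
/-- Accessor value. [folklore] -/
@[simp] theorem XpF_X : CpF S (Xrec n kb x) = ones (S.p.eval n) := by simp [CpF, ones]
/-- Accessor value. [folklore] -/
theorem XdF_X (hS : S.WF) : CdF S (Xrec n kb x) = ones (S.dL n) := by rw [CdF, Function.comp_apply, XnF_X, hS.dLF_apply]
/-- Accessor value. [folklore] -/
theorem XRF_X (hS : S.WF) : CRF S (Xrec n kb x) = ones (S.R n) := by rw [CRF, Function.comp_apply, XnF_X, hS.RF_apply]

/-- Accessor bricks are in FP. [folklore] -/
theorem XnF_mem_FP : CnF ∈ FP := fstF_mem_FP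
/-- Accessor bricks are in FP. [folklore] -/
theorem XkF_mem_FP : CkbF ∈ FP := nthF_mem_FP 1
/-- Accessor bricks are in FP. [folklore] -/
theorem XxF_mem_FP : CxF ∈ FP := sndPow_mem_FP 1
/-- Accessor bricks are in FP. [folklore] -/
theorem XpF_mem_FP : CpF S ∈ FP := comp_mem_FP (polyFn_mem_FP _) XnF_mem_FP
/-- Accessor bricks are in FP. [folklore] -/
theorem XdF_mem_FP (hS : S.WF) : CdF S ∈ FP := comp_mem_FP hS.dLF_mem XnF_mem_FP
/-- Accessor bricks are in FP. [folklore] -/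
theorem XRF_mem_FP (hS : S.WF) : CRF S ∈ FP := comp_mem_FP hS.RF_mem XnF_mem_FP

/-- On the loop record: key `r`, `(kb ⇂ r·p n) ↾ p n`. [cite: Goldreich2004, Construction 6.4.22] -/
noncomputable def keyF : List Bool → List Bool :=
  takeFn ∘ fanoutFn (CpF S ∘ nthF 0) (dropFn ∘ fanoutFn (HashBricks.umulFn ∘ fanoutFn (nthF 2) (CpF S ∘ nthF 0)) (CkbF ∘ nthF 0))

/-- On the loop record: the basic index `1ⁿ 0 key_r`. [folklore] -/
noncomputable def idxF : List Bool → List Bool := catF (CnF ∘ nthF 0) (List.cons false ∘ keyF S)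

/-- On the loop record: `h_{s_r}(st)`. [cite: Goldreich2004, Construction 6.4.22] -/
noncomputable def stepF : List Bool → List Bool := S.hb ∘ fanoutFn (idxF S) (sndPow 2)

/-- On the loop record: the extension bit `x_{d+r}` (as a string of length `≤ 1`). [cite: Goldreich2004, Construction 6.4.22] -/
noncomputable def cbitF : List Bool → List Bool :=
  takeFn ∘ fanoutFn (fun _ => [true]) (dropFn ∘ fanoutFn (catF (CdF S ∘ nthF 0) (nthF 2)) (CxF ∘ nthF 0))

/-- The loop body `⟨1ʳ, st⟩ ↦ ⟨1ʳ⁺¹, h_{s_r}(st) ++ x_{d+r}⟩`, clipped to `|X| + 1` symbols. [cite: Goldreich2004, Construction 6.4.22] -/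
noncomputable def bodyF : List Bool → List Bool := clipF 1 (fanoutFn (List.cons true ∘ nthF 2) (catF (stepF S) (cbitF S)))

/-- Value of `keyF`. [folklore] -/
theorem keyF_Z (cnt : List Bool) (r : ℕ) (st : List Bool) : keyF S (Zrec n kb x cnt r st) = keyAt S n kb r := by
  rw [keyF, Zrec]
  simp only [Function.comp_apply, fanoutFn_apply, nthF_zero_boolPair, nthF_succ_boolPair, XpF_X, XkF_X,
    HashBricks.umulFn_boolPair, takeFn_boolPair, dropFn_boolPair, keyAt]
  simp [ones]

/-- Value of `idxF`. [folklore] -/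
theorem idxF_Z (cnt : List Bool) (r : ℕ) (st : List Bool) : idxF S (Zrec n kb x cnt r st) = idxAt S n kb r := by
  rw [idxF, catF_apply, Function.comp_apply, Function.comp_apply, keyF_Z, Zrec, nthF_zero_boolPair, XnF_X, idxAt]

/-- Value of `stepF`. [folklore] -/
theorem stepF_Z (cnt : List Bool) (r : ℕ) (st : List Bool) :
    stepF S (Zrec n kb x cnt r st) = S.hb (boolPair (idxAt S n kb r) st) := by
  rw [stepF, Function.comp_apply, fanoutFn_apply, idxF_Z]
  simp [Zrec]

/-- Value of `cbitF`. [folklore] -/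
theorem cbitF_Z (hS : S.WF) (cnt : List Bool) (r : ℕ) (st : List Bool) :
    cbitF S (Zrec n kb x cnt r st) = (x.drop (S.dL n + r)).take 1 := by
  rw [cbitF, Zrec]
  simp only [Function.comp_apply, fanoutFn_apply, nthF_zero_boolPair, nthF_succ_boolPair, catF_apply, XdF_X S hS, XxF_X,
    takeFn_boolPair, dropFn_boolPair]
  simp [ones]

/-- The unclipped body on the loop record. [folklore] -/
theorem body_raw_Z (hS : S.WF) (cnt : List Bool) (r : ℕ) (st : List Bool) :
    fanoutFn (List.cons true ∘ nthF 2) (catF (stepF S) (cbitF S)) (Zrec n kb x cnt r st) =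
      boolPair (ones (r + 1)) (S.hb (boolPair (idxAt S n kb r) st) ++ (x.drop (S.dL n + r)).take 1) := by
  rw [fanoutFn_apply, catF_apply, stepF_Z, cbitF_Z S hS]
  simp [Zrec, ones, List.replicate_succ]

/-- The clip is inactive on the intended records. [folklore] -/
theorem bodyF_Z (hS : S.WF) (cnt : List Bool) {r : ℕ} {st : List Bool} (hkb : (S.R n + 1) * S.p.eval n ≤ kb.length)
    (hx : x.length = S.dL n + S.R n) (hr : r < S.R n) (hst : st.length = S.dL n) :
    bodyF S (Zrec n kb x cnt r st) = boolPair (ones (r + 1)) (S.hb (boolPair (idxAt S n kb r) st) ++ (x.drop (S.dL n + r)).take 1) := by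
  rw [bodyF, clipF_eq_self, body_raw_Z S hS]
  rw [body_raw_Z S hS, length_boolPair]
  have hlen : (S.hb (boolPair (idxAt S n kb r) st)).length = S.dL n - 1 := hS.length_hb n _ _ (length_keyAt hkb hr.le) hst
  have h1 : S.R n + 1 ≤ kb.length := le_trans (by have := hS.one_le_p n; nlinarith) hkb
  simp only [ones, List.length_replicate, List.length_append, hlen, List.length_take, List.length_drop, hx, Zrec, Xrec,
    fstF_boolPair, length_boolPair, one_mul]
  have := hS.two_le_dL n
  omega

/-- **The loop computes the chain**: from `⟨1ʳ, z_r⟩` with `k` active rounds, `r + k ≤ R`, the model ends at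
`⟨1^{r+k}, z_{r+k}⟩`. [cite: Goldreich2004, Construction 6.4.22] -/
theorem loopModel_bodyF (hS : S.WF) (hkb : (S.R n + 1) * S.p.eval n ≤ kb.length) (hx : x.length = S.dL n + S.R n) :
    ∀ (k r : ℕ), r + k ≤ S.R n →
      loopModel (bodyF S) (Xrec n kb x) k (boolPair (ones r) (chainSt S n kb x r)) = boolPair (ones (r + k)) (chainSt S n kb x (r + k))
  | 0, _, _ => rfl
  | k + 1, r, hk => by
    rw [loopModel, show boolPair (Xrec n kb x) (boolPair (encodeNat (k + 1)) (boolPair (ones r) (chainSt S n kb x r))) =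
      Zrec n kb x (encodeNat (k + 1)) r (chainSt S n kb x r) from rfl,
      bodyF_Z S hS _ hkb hx (by omega) (length_chainSt hS hkb hx (by omega)),
      show S.hb (boolPair (idxAt S n kb r) (chainSt S n kb x r)) ++ (x.drop (S.dL n + r)).take 1 = chainSt S n kb x (r + 1) from rfl,
      loopModel_bodyF hS hkb hx k (r + 1) (by omega)]
    congr 2 <;> omega

/-- Growth of the clipped body. [folklore] -/
theorem length_bodyF_le (z : List Bool) : (bodyF S z).length ≤ (sndPow 1 z).length + 1 * ((fstF z).length + 1) := by
  rw [bodyF]; exact (length_clipF_le _ _ _).trans (Nat.le_add_left _ _)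

/-- `keyF ∈ FP`. [folklore] -/
theorem keyF_mem_FP : keyF S ∈ FP :=
  comp_mem_FP takeFn_mem_FP (fanoutFn_mem_FP (comp_mem_FP (XpF_mem_FP S) (nthF_mem_FP 0))
    (comp_mem_FP dropFn_mem_FP (fanoutFn_mem_FP
      (comp_mem_FP HashBricks.umulFn_mem_FP (fanoutFn_mem_FP (nthF_mem_FP 2) (comp_mem_FP (XpF_mem_FP S) (nthF_mem_FP 0))))
      (comp_mem_FP XkF_mem_FP (nthF_mem_FP 0)))))

/-- `idxF ∈ FP`. [folklore] -/
theorem idxF_mem_FP : idxF S ∈ FP :=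
  catF_mem_FP (comp_mem_FP XnF_mem_FP (nthF_mem_FP 0)) (comp_mem_FP (cons_mem_FP false) (keyF_mem_FP S))

/-- `stepF ∈ FP` (for `hb ∈ FP`). [folklore] -/
theorem stepF_mem_FP (hS : S.WF) : stepF S ∈ FP := comp_mem_FP hS.hb_mem (fanoutFn_mem_FP (idxF_mem_FP S) (sndPow_mem_FP 2))

/-- `cbitF ∈ FP`. [folklore] -/
theorem cbitF_mem_FP (hS : S.WF) : cbitF S ∈ FP :=
  comp_mem_FP takeFn_mem_FP (fanoutFn_mem_FP (const_mem_FP _)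
    (comp_mem_FP dropFn_mem_FP (fanoutFn_mem_FP (catF_mem_FP (comp_mem_FP (XdF_mem_FP S hS) (nthF_mem_FP 0)) (nthF_mem_FP 2))
      (comp_mem_FP XxF_mem_FP (nthF_mem_FP 0)))))

/-- `bodyF ∈ FP`. [folklore] -/
theorem bodyF_mem_FP (hS : S.WF) : bodyF S ∈ FP :=
  clipF_mem_FP 1 (fanoutFn_mem_FP (comp_mem_FP (cons_mem_FP true) (nthF_mem_FP 2)) (catF_mem_FP (stepF_mem_FP S hS) (cbitF_mem_FP S hS)))

/-- The loop initialisation `X ↦ ⟨X, ⟨bin R, ⟨1⁰, x ↾ d⟩⟩⟩`. [folklore] -/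
noncomputable def initF : List Bool → List Bool :=
  fanoutFn id (fanoutFn (lenBinF ∘ CRF S) (fanoutFn (fun _ => []) (takeFn ∘ fanoutFn (CdF S) CxF)))

/-- The clocked loop: `PR(|X|) ≥ R` rounds. [folklore] -/
noncomputable def loopF (z : List Bool) : List Bool := (loopStep (bodyF S))^[S.PR.eval (fstF z).length] z

/-- **The chain brick** on `X = ⟨1ⁿ, ⟨kb, x⟩⟩`. [cite: Goldreich2004, Construction 6.4.22] -/
noncomputable def chainP : List Bool → List Bool := stepF S ∘ loopF S ∘ initF S

/-- Value of the initialisation. [folklore] -/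
theorem initF_X (hS : S.WF) : initF S (Xrec n kb x) = Zrec n kb x (encodeNat (S.R n)) 0 (x.take (S.dL n)) := by
  rw [initF, fanoutFn_apply, fanoutFn_apply, fanoutFn_apply, id, Function.comp_apply, XRF_X S hS, lenBinF_apply,
    Function.comp_apply, fanoutFn_apply, XdF_X S hS, XxF_X, takeFn_boolPair]
  simp [Zrec, ones]

/-- **`chainP X = chainOutStr`** on well-formed records. [cite: Goldreich2004, Construction 6.4.22] -/
theorem chainP_apply (hS : S.WF) (hkb : (S.R n + 1) * S.p.eval n ≤ kb.length) (hx : x.length = S.dL n + S.R n) :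
    chainP S (Xrec n kb x) = chainOutStr S n kb x := by
  have hR : S.R n ≤ S.PR.eval (Xrec n kb x).length :=
    (hS.R_le n).trans (TM2Iter.eval_mono S.PR (by simp [Xrec, ones]; omega))
  rw [chainP, Function.comp_apply, Function.comp_apply, initF_X S hS, loopF, Zrec, fstF_boolPair, iterate_loopStep _ _ _ _ _ hR,
    show x.take (S.dL n) = chainSt S n kb x 0 from rfl, loopModel_bodyF S hS hkb hx (S.R n) 0 (by omega), Nat.zero_add,
    show boolPair (Xrec n kb x) (boolPair [] (boolPair (ones (S.R n)) (chainSt S n kb x (S.R n)))) =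
      Zrec n kb x [] (S.R n) (chainSt S n kb x (S.R n)) from rfl, stepF_Z, chainOutStr]

/-- `initF ∈ FP`. [folklore] -/
theorem initF_mem_FP (hS : S.WF) : initF S ∈ FP :=
  fanoutFn_mem_FP (PolyTimeComputable.id _) (fanoutFn_mem_FP (comp_mem_FP lenBinF_mem_FP (XRF_mem_FP S hS))
    (fanoutFn_mem_FP (const_mem_FP _) (comp_mem_FP takeFn_mem_FP (fanoutFn_mem_FP (XdF_mem_FP S hS) XxF_mem_FP))))

/-- `loopF ∈ FP`. [folklore] -/
theorem loopF_mem_FP (hS : S.WF) : loopF S ∈ FP := loopFn_mem_FP (bodyF_mem_FP S hS) (length_bodyF_le S) S.PR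

/-- `chainP ∈ FP`. [cite: Goldreich2004, Construction 6.4.22 ("polynomial-time")] -/
theorem chainP_mem_FP (hS : S.WF) : chainP S ∈ FP :=
  comp_mem_FP (stepF_mem_FP S hS) (comp_mem_FP (loopF_mem_FP S hS) (initF_mem_FP S hS))

/-! ### The composed hash brick on `⟨s, x⟩` -/

/-- The level of `s` in unary, `1^{nOf p₂ |s|}`, from `⟨s, x⟩`. [folklore] -/
noncomputable def lvF : List Bool → List Bool := LenPres.nOfFn S.p₂ ∘ fstF

/-- The record `X = ⟨1^{lv}, ⟨s ⇂ (lv+1), x⟩⟩` from `⟨s, x⟩`. [folklore] -/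
noncomputable def prepF : List Bool → List Bool :=
  fanoutFn (lvF S) (fanoutFn (dropFn ∘ fanoutFn (catF (lvF S) fun _ => [true]) fstF) sndF)

/-- The range length `dL(lv) − 1` in unary, from `⟨s, x⟩`. [folklore] -/
noncomputable def rlenF : List Bool → List Bool := dropFn ∘ fanoutFn (fun _ => [true]) (S.dLF ∘ lvF S)

/-- **The composed hash brick**: the chain, cut and padded to `dL(lv) − 1` symbols at the level of `|s|`.
[cite: Goldreich2004, Construction 6.4.22 with Def. 6.4.19 (range)] -/
noncomputable def hashC : List Bool → List Bool :=
  catF (takeFn ∘ fanoutFn (rlenF S) (chainP S ∘ prepF S)) (Kannan.zerosFn ∘ dropFn ∘ fanoutFn (chainP S ∘ prepF S) (rlenF S))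

/-- Value of `lvF`. [folklore] -/
theorem lvF_apply (s x : List Bool) : lvF S (boolPair s x) = ones (LenPres.nOf S.p₂ s.length) := by
  rw [lvF, Function.comp_apply, fstF_boolPair, LenPres.nOfFn_apply]

/-- Value of `rlenF`. [folklore] -/
theorem rlenF_apply (hS : S.WF) (s x : List Bool) : rlenF S (boolPair s x) = ones (S.dL (LenPres.nOf S.p₂ s.length) - 1) := by
  rw [rlenF, Function.comp_apply, fanoutFn_apply, Function.comp_apply, lvF_apply, hS.dLF_apply, dropFn_boolPair]
  simp [ones]

/-- `hashC ⟨s, x⟩ = fitLen (dL(lv) − 1) (chainP (prepF ⟨s, x⟩))`. [folklore] -/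
theorem hashC_eq (hS : S.WF) (s x : List Bool) :
    hashC S (boolPair s x) = fitLen (S.dL (LenPres.nOf S.p₂ s.length) - 1) (chainP S (prepF S (boolPair s x))) := by
  rw [hashC, catF_apply, Function.comp_apply, fanoutFn_apply, Function.comp_apply, Function.comp_apply, Function.comp_apply,
    fanoutFn_apply, Function.comp_apply, rlenF_apply S hS, takeFn_boolPair, dropFn_boolPair, Kannan.zerosFn_apply, fitLen]
  simp [ones]

/-- **Range on all inputs**: `|hashC ⟨s, x⟩| = dL(nOf p₂ |s|) − 1`. [cite: Goldreich2004, Def. 6.4.19] -/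
theorem length_hashC (hS : S.WF) (s x : List Bool) : (hashC S (boolPair s x)).length = S.dL (LenPres.nOf S.p₂ s.length) - 1 := by
  rw [hashC_eq S hS, length_fitLen]

/-- Value of `prepF` on a well-formed index. [folklore] -/
theorem prepF_apply (n : ℕ) {kb : List Bool} (hkb : kb.length = S.p₂.eval n) (x : List Bool) :
    prepF S (boolPair (ones n ++ false :: kb) x) = Xrec n kb x := by
  rw [prepF, fanoutFn_apply, fanoutFn_apply, Function.comp_apply, fanoutFn_apply, catF_apply, lvF_apply, nOf_length_idx S.p₂ n hkb,
    fstF_boolPair, sndF_boolPair, dropFn_boolPair, Xrec]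
  have h : (ones n ++ [true]).length = (ones n ++ [false]).length := by simp
  rw [h, show ones n ++ false :: kb = (ones n ++ [false]) ++ kb by simp, List.drop_left]

/-- **The value on well-formed indices**: for `s = 1ⁿ 0 kb` with `|kb| = p₂ n` and `|x| = dL n + R n`,
`hashC ⟨s, x⟩ = chainOutStr S n kb x`. [cite: Goldreich2004, Construction 6.4.22] -/
theorem hashC_apply (hS : S.WF) {n : ℕ} {kb x : List Bool} (hkb : kb.length = S.p₂.eval n) (hx : x.length = S.dL n + S.R n) :
    hashC S (boolPair (ones n ++ false :: kb) x) = chainOutStr S n kb x := by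
  have hkb' : (S.R n + 1) * S.p.eval n ≤ kb.length := hkb ▸ hS.p₂_ge n
  rw [hashC_eq S hS, nOf_length_idx S.p₂ n hkb, prepF_apply S n hkb, chainP_apply S hS hkb' hx,
    fitLen_of_length_eq (length_chainOutStr hS hkb' hx)]

/-- `hashC ∈ FP`. [cite: Goldreich2004, Construction 6.4.22 ("polynomial-time")] -/
theorem hashC_mem_FP (hS : S.WF) : hashC S ∈ FP := by
  have hlv : lvF S ∈ FP := comp_mem_FP (LenPres.nOfFn_mem_FP S.p₂) fstF_mem_FP
  have hprep : prepF S ∈ FP := fanoutFn_mem_FP hlv (fanoutFn_mem_FP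
    (comp_mem_FP dropFn_mem_FP (fanoutFn_mem_FP (catF_mem_FP hlv (const_mem_FP _)) fstF_mem_FP)) sndF_mem_FP)
  have hrlen : rlenF S ∈ FP := comp_mem_FP dropFn_mem_FP (fanoutFn_mem_FP (const_mem_FP _) (comp_mem_FP hS.dLF_mem hlv))
  have hcore : chainP S ∘ prepF S ∈ FP := comp_mem_FP (chainP_mem_FP S hS) hprep
  exact catF_mem_FP (comp_mem_FP takeFn_mem_FP (fanoutFn_mem_FP hrlen hcore))
    (comp_mem_FP Kannan.zerosFn_mem_FP (comp_mem_FP dropFn_mem_FP (fanoutFn_mem_FP hcore hrlen)))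

end Bricks

/-! ### The composed collection -/

/-- **The Merkle–Damgård composition at a fixed level** as a hash collection: `p₂`-shaped, hash `hashC`.
[cite: Goldreich2004, Construction 6.4.22] -/
noncomputable def compose : HashCollection := pShaped S.p₂ (hashC S)

/-- The domain length of the composition at index length `L`: `dL + R` at the level `nOf p₂ L`. [cite: Goldreich2004, Construction 6.4.22] -/
def dLenC (L : ℕ) : ℕ := S.dL (LenPres.nOf S.p₂ L) + S.R (LenPres.nOf S.p₂ L)

/-- The range length of the composition at index length `L`: `dL − 1` at the level `nOf p₂ L`. [cite: Goldreich2004, Construction 6.4.22] -/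
def rLenC (L : ℕ) : ℕ := S.dL (LenPres.nOf S.p₂ L) - 1

/-- **Range**: `|h_s(x)| = rLenC |s|` for every `s`, `x`. [cite: Goldreich2004, Def. 6.4.19] -/
theorem length_compose_hash (hS : S.WF) (s x : List Bool) : ((compose S).hash s x).length = rLenC S s.length :=
  length_hashC S hS s x

/-- **Efficiency**: the index sampler is PPT and the evaluation is polynomial-time. [cite: Goldreich2004, Construction 6.4.22; Def. 6.4.19 (2)] -/
theorem isEfficient_compose (hS : S.WF) : (compose S).IsEfficient := by
  constructor
  · refine ⟨?_, S.p₂, fun L => le_rfl⟩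
    have hg : catF fstF (List.cons false ∘ sndF) ∈ FP := catF_mem_FP fstF_mem_FP (comp_mem_FP (cons_mem_FP false) sndF_mem_FP)
    obtain ⟨pc, Mc, hM⟩ := hg
    refine ⟨pc, Mc, fun q => ?_⟩
    have h := hM (boolPair (unaryEncodeNat q.1) q.2)
    rw [id, catF_apply, fstF_boolPair, Function.comp_apply, sndF_boolPair] at h
    exact h
  · obtain ⟨pc, Mc, hM⟩ := hashC_mem_FP S hS
    exact ⟨pc, Mc, fun q => hM (boolPair q.1 q.2)⟩

/-- **Index length**: every index in the range of `I(1ⁿ)` has length `LenPres.M p₂ n`. [cite: Goldreich2004, Def. 6.4.19 (1)] -/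
theorem length_index_compose {n : ℕ} {s : List Bool} (hs : s ∈ ((compose S).indexPMF n).support) : s.length = LenPres.M S.p₂ n :=
  length_index_pShaped hs

/-- The coin budget of the composed sampler is `p₂`. [folklore] -/
@[simp] theorem compose_index_coinLen (L : ℕ) : (compose S).index.coinLen L = S.p₂.eval L := rfl

/-- **The value of the composition on well-formed indices**: the chained value. [cite: Goldreich2004, Construction 6.4.22] -/
theorem compose_hash_eq (hS : S.WF) {n : ℕ} {kb x : List Bool} (hkb : kb.length = S.p₂.eval n) (hx : x.length = S.dL n + S.R n) :
    (compose S).hash (ones n ++ false :: kb) x = chainOutStr S n kb x :=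
  hashC_apply S hS hkb hx

end MDCompose

end Literature.Computability.Cryptography
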